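import Literature.NumberTheory.LFunctions.MertensErrorTermsMeanValueRHProofs
import Literature.NumberTheory.LFunctions.LittlewoodOscillationInputsProofs
import HarnessLib

/-!
# RH-EQUIVALENT literature, proof layer — «nothing here bears on the truth of RH»
# Zhao 2025, Theorem 1 (`i = 1`), necessity half PROVED: `∫₂^X E₁(x) dx > 0 (X > 2) ⟹ RH`

Proof companion of `MertensErrorTermsMeanValueRH.lean` / `MertensErrorTermsMeanValueRHProofs.lean` (T. Zhao,
Res. Number Theory 11 (2025) 62 = arXiv:2411.18903 [bib: `Zhao2025MertensMean`]); theorems only, no definition,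
no named fact. It proves the implication (b) ⟹ (a) of the source's Theorem 1 for `i = 1` — the `←` direction of
clause 1 of the named fact `Zhao2025MertensMean_thm1` — in the slightly stronger eventual form

  `(∃ X₁, ∀ X > X₁, ∫₂^X E₁(x) dx ≥ 0) ⟹ RiemannHypothesis`   (`Zhao2025.riemannHypothesis_of_integral_E₁_nonneg`),

following §3 of the source ("Proof of Theorem 1, necessity": Landau's oscillation theorem applied to the
integrated error term, "a standard application of Landau's oscillation theorem (again see the proof of [MV])").
With `g(t) = (θ(t) − t)/t²`, `T(x) = ∫_x^∞ g`, `C = ∫_2^∞ g`, `C₁ = ∫_1^∞ g`, the tree's (2.1)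
(`Zhao2025.integral_E₁_eq`) reads `∫₂^X E₁ = L(X) := 2C − X·T(X)` (`X ≥ 2`). The steps, all proved here:

* `Zhao2025.mellinIoi_mul_tail` (Fubini): `∫_1^∞ x T(x) x^{-s-1} dx = (∫_1^∞ (θ(t) − t) t^{-s-1} dt − C₁)/(1 − s)`, `σ > 1`;
* `Zhao2025.mellinIoi_theta_sub_self`: `∫_1^∞ (θ(t) − t) t^{-s-1} dt = −(ζ₁'/ζ₁(s) + 1)/s − Q(s)`, where
  `Q(s) = ∫_1^∞ (ψ − θ) x^{-s-1} dx` is holomorphic on `σ > 1/2` (`ψ − θ ≪ √x`), from the tree's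
  `PsiOmega.mellinIoi_psi_sub_self` (MV Thm 1.3; the source's Lemma 7 (1) is its value at `s = 1`);
* `Zhao2025.mellinIoi_zhaoL`: the transform of `L` on `σ > 1` is `2C/s + B(s)/(s − 1)`,
  `B(s) = −(ζ₁'/ζ₁(s) + 1)/s − Q(s) − C₁`, and `B(1) = 0` by `ζ₁'(1) = γ` (Mathlib), `Q(1) = Σ_p log p/(p(p−1))`
  and `C₁ = −1 − γ − Σ_p log p/(p(p−1))` (the tree's Rosser–Schoenfeld constants) — this is where the source's
  "it is analytic at `s = 1`" (Lemma 7) enters; the continuation is `Φ(s) = 2C/s + dslope B 1 s`;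
* `Zhao2025.false_of_zhaoL_nonneg_of_zero`: if `L ≥ 0` beyond `X₁` and `ζ(ρ₀) = 0` with `Re ρ₀ > 1/2`, contradiction:
  Landau's theorem (the tree's `Landau.integrableOn_of_differentiableOn_union_convex`, MV Lemma 15.1) on the strip
  about `(b, ∞)` free of zeros (`1/2 < b < Re ρ₀`) makes the transform holomorphic on `Re s > b`, so `ζ₁' = a ζ₁` there
  with `a` holomorphic and the zero `ρ₀` propagates to `ζ₁ ≡ 0` (`PsiOmega.eq_zero_of_deriv_eq_mul`), contradicting
  `ζ₁(1) = 1` — verbatim the architecture of the tree's `PsiOmega.false_of_nonneg_of_zero` (MV Thm 15.2);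
* the symmetry `ρ ↦ 1 − ρ` (`quasiRiemannHypothesis_one_half_iff_holds`) turns "no zero with `Re ρ > 1/2`" into RH;
* the same argument for `η L + M` (`η = ±1`) gives, if RH fails, arbitrarily large positive AND negative values of
  `∫₂^X E₁` (`Zhao2025.frequently_lt_integral_E₁_of_not_RH`, `…_integral_E₁_lt_of_not_RH`: §3's claim), and with
  the power term `κ x^c` of the source's `A₁` (core: `Zhao2025.false_of_rpow_affine_zhaoL_nonneg_of_zero`) the rate of
  (3.1) zero by zero: `∫₂^X E₁ > X^c` and `< −X^c` for arbitrarily large `X`, every `c < Re ρ₀`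
  (`Zhao2025.frequently_rpow_lt_integral_E₁_of_zero`, `…_integral_E₁_lt_neg_rpow_of_zero`).

The (a) ⟹ (b) half (explicit formula under RH, §2 of the source) is not done here.
-/

noncomputable section

open Complex Filter Topology Set MeasureTheory
open scoped Real Chebyshev

namespace Literature.NumberTheory.LFunctions

namespace Zhao2025

open Landau Nicolas PsiOmega

/-! ### The kernel `g = (θ − t)/t²` on `(1, ∞)` and its tails `T(x) = ∫_x^∞ g` -/

/-- `g` is integrable on `(1, ∞)` (the tree's pieces on `(1, 2]` and `(2, ∞)`).
[cite: Zhao2025MertensMean, §2 (after (2.1)) and §3] -/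
theorem integrableOn_thetaKernel_Ioi_one :
    IntegrableOn (fun t : ℝ => (θ t - t) / t ^ 2) (Ioi 1) := by
  rw [← Ioc_union_Ioi_eq_Ioi (one_le_two : (1 : ℝ) ≤ 2)]
  exact RosserSchoenfeld.integrableOn_theta_sub_div_sq_Ioc_one_two.union
    Mertens.integrableOn_theta_sub_div_sq

/-- `|T(x)| ≤ ∫_1^∞ |g|` for `x ≥ 1`. [cite: Zhao2025MertensMean, §3 (proof of Thm 1, necessity)] -/
theorem abs_tail_le {x : ℝ} (hx : 1 ≤ x) :
    |∫ t in Ioi x, (θ t - t) / t ^ 2| ≤ ∫ t in Ioi 1, |(θ t - t) / t ^ 2| := by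
  calc |∫ t in Ioi x, (θ t - t) / t ^ 2| ≤ ∫ t in Ioi x, |(θ t - t) / t ^ 2| :=
        abs_integral_le_integral_abs
    _ ≤ ∫ t in Ioi 1, |(θ t - t) / t ^ 2| :=
        setIntegral_mono_set integrableOn_thetaKernel_Ioi_one.abs
          (Eventually.of_forall fun _ => abs_nonneg _) (Ioi_subset_Ioi hx).eventuallyLE

/-- `x ↦ T(x) = ∫_x^∞ g` is measurable (Fubini measurability of a parametric integral).
[cite: Zhao2025MertensMean, §3 (proof of Thm 1, necessity)] -/
theorem measurable_tail : Measurable fun x : ℝ => ∫ t in Ioi x, (θ t - t) / t ^ 2 := by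
  set F : ℝ → ℝ → ℝ := fun x t => if x < t then (θ t - t) / t ^ 2 else 0 with hF
  have hFm : Measurable (Function.uncurry F) := by
    have : Function.uncurry F =
        fun p : ℝ × ℝ => if p.1 < p.2 then (θ p.2 - p.2) / p.2 ^ 2 else 0 := by
      funext p; rfl
    rw [this]
    exact Measurable.ite (measurableSet_lt measurable_fst measurable_snd)
      (measurable_thetaKernel.comp measurable_snd) measurable_const
  have heq : (fun x => ∫ t, F x t) = fun x : ℝ => ∫ t in Ioi x, (θ t - t) / t ^ 2 := by
    funext x
    rw [← integral_indicator measurableSet_Ioi]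
    rfl
  rw [← heq]
  exact (hFm.stronglyMeasurable.integral_prod_right (ν := volume)).measurable

/-- `|x T(x)| ≤ (∫_1^∞ |g|)·x` for `x ≥ 1`. [cite: Zhao2025MertensMean, §3 (proof of Thm 1, necessity)] -/
theorem abs_mul_tail_le {x : ℝ} (hx : 1 ≤ x) :
    |x * ∫ t in Ioi x, (θ t - t) / t ^ 2| ≤ (∫ t in Ioi 1, |(θ t - t) / t ^ 2|) * x := by
  rw [abs_mul, abs_of_nonneg (by linarith : (0 : ℝ) ≤ x), mul_comm]
  exact mul_le_mul_of_nonneg_right (abs_tail_le hx) (by linarith)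

/-- Absolute convergence of `∫_1^∞ x T(x) x^{-σ-1} dx` for `σ > 1`. [cite: Zhao2025MertensMean, §3 (proof of Thm 1, necessity)] -/
theorem integrableOn_mul_tail_rpow {σ : ℝ} (hσ : 1 < σ) :
    IntegrableOn (fun x : ℝ => (x * ∫ t in Ioi x, (θ t - t) / t ^ 2) * x ^ (-(σ + 1))) (Ioi 1) := by
  set K : ℝ := ∫ t in Ioi 1, |(θ t - t) / t ^ 2| with hK
  refine Integrable.mono'
    ((integrableOn_Ioi_rpow_of_lt (show -σ < -1 by linarith) zero_lt_one).const_mul K)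
    (((measurable_id.mul measurable_tail).mul (measurable_id.pow_const _)).aestronglyMeasurable) ?_
  rw [ae_restrict_iff' measurableSet_Ioi]
  refine ae_of_all _ fun x hx => ?_
  have hx1 : 1 < x := hx
  have hx0 : 0 < x := by linarith
  rw [Real.norm_eq_abs, abs_mul, abs_of_nonneg (Real.rpow_nonneg hx0.le _)]
  calc |x * ∫ t in Ioi x, (θ t - t) / t ^ 2| * x ^ (-(σ + 1)) ≤ K * x * x ^ (-(σ + 1)) :=
        mul_le_mul_of_nonneg_right (abs_mul_tail_le hx1.le) (Real.rpow_nonneg hx0.le _)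
    _ = K * x ^ (-σ) := by
        rw [show (-(σ + 1)) = -σ - 1 by ring, Real.rpow_sub hx0, Real.rpow_one]
        field_simp

/-- Absolute convergence of `∫_1^∞ (θ(x) − x) x^{-σ-1} dx` for `σ > 1` (`|θ(x) − x| ≤ 3x`).
[cite: Zhao2025MertensMean, §3 (proof of Thm 1, necessity)] -/
theorem integrableOn_theta_sub_self_rpow {σ : ℝ} (hσ : 1 < σ) :
    IntegrableOn (fun x : ℝ => (θ x - x) * x ^ (-(σ + 1))) (Ioi 1) := by
  refine Integrable.mono'
    ((integrableOn_Ioi_rpow_of_lt (show -σ < -1 by linarith) zero_lt_one).const_mul 3)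
    (((Mertens.measurable_theta.sub measurable_id).mul (measurable_id.pow_const _)).aestronglyMeasurable) ?_
  rw [ae_restrict_iff' measurableSet_Ioi]
  refine ae_of_all _ fun x hx => ?_
  have hx1 : 1 < x := hx
  have hx0 : 0 < x := by linarith
  rw [Real.norm_eq_abs, abs_mul, abs_of_nonneg (Real.rpow_nonneg hx0.le _)]
  calc |θ x - x| * x ^ (-(σ + 1)) ≤ 3 * x * x ^ (-(σ + 1)) :=
        mul_le_mul_of_nonneg_right (Mertens.abs_theta_sub_self_le hx0.le) (Real.rpow_nonneg hx0.le _)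
    _ = 3 * x ^ (-σ) := by
        rw [show (-(σ + 1)) = -σ - 1 by ring, Real.rpow_sub hx0, Real.rpow_one]
        field_simp

/-- Absolute convergence of `Q(σ) = ∫_1^∞ (ψ − θ) x^{-σ-1} dx` for `σ > 1/2` (`0 ≤ ψ − θ ≤ C√x`, Mathlib), the
source's (1.9) `ψ = θ + √x + o(√x)` in the weak form that suffices. [cite: Zhao2025MertensMean, §1.4 (1.9) and §3] -/
theorem integrableOn_psi_sub_theta_rpow {σ : ℝ} (hσ : 1 / 2 < σ) :
    IntegrableOn (fun x : ℝ => (ψ x - θ x) * x ^ (-(σ + 1))) (Ioi 1) := by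
  obtain ⟨C, hC⟩ := Chebyshev.psi_sub_theta_le_mul_sqrt
  have hC' : ∀ x : ℝ, 1 < x → |ψ x - θ x| ≤ max C 0 * x ^ (1 / 2 : ℝ) := by
    intro x _
    rw [abs_of_nonneg (sub_nonneg.2 (Chebyshev.theta_le_psi x)), ← Real.sqrt_eq_rpow]
    exact (hC x).trans (mul_le_mul_of_nonneg_right (le_max_left _ _) (Real.sqrt_nonneg _))
  refine Integrable.mono' ((integrableOn_rpow_rpow (b := 1 / 2) hσ).const_mul (max C 0))
    (((measurable_psi.sub Mertens.measurable_theta).mul (measurable_id.pow_const _)).aestronglyMeasurable) ?_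
  rw [ae_restrict_iff' measurableSet_Ioi]
  refine ae_of_all _ fun x hx => ?_
  have hx1 : 1 < x := hx
  have hx0 : 0 < x := by linarith
  rw [Real.norm_eq_abs, abs_mul, abs_of_nonneg (Real.rpow_nonneg hx0.le _), ← mul_assoc]
  exact mul_le_mul_of_nonneg_right (hC' x hx1) (Real.rpow_nonneg hx0.le _)

/-! ### The transforms on `σ > 1` -/

/-- `∫_1^∞ c · x^{-s-1} dx = c/s` for `Re s > 0`. [cite: Zhao2025MertensMean, §3 (proof of Thm 1, necessity)] -/
theorem mellinIoi_const (c : ℝ) {s : ℂ} (hs : 0 < s.re) : mellinIoi (fun _ : ℝ => c) s = c / s := by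
  have h1 : (fun _ : ℝ => c) = fun x : ℝ => c * x ^ (-(0 : ℝ)) := by
    funext x; rw [neg_zero, Real.rpow_zero, mul_one]
  rw [h1, mellinIoi_const_mul, mellinIoi_rpow_neg (b := 0) (by simpa using hs)]
  push_cast
  ring

/-- **The `θ`-transform**: `∫_1^∞ (θ(x) − x) x^{-s-1} dx = −(ζ₁'/ζ₁(s) + 1)/s − ∫_1^∞ (ψ − θ) x^{-s-1} dx` for `σ > 1`
(the source's `∫_1^∞ (ψ(x) − x) x^{-s-1} dx = −ζ'(s)/(sζ(s)) − 1/(s−1)`, Lemma 7, combined with `θ = ψ − (ψ − θ)`).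
[cite: Zhao2025MertensMean, §3 Lemma 7 (proof)] -/
theorem mellinIoi_theta_sub_self {s : ℂ} (hs : 1 < s.re) :
    mellinIoi (fun x : ℝ => θ x - x) s =
      -(logDeriv riemannZeta₁ s + 1) / s - mellinIoi (fun x : ℝ => ψ x - θ x) s := by
  have hψ := integrable_ofReal_mul_cpow (g := fun x : ℝ => ψ x - x) measurable_psi_sub_self
    (σ₁ := (1 + s.re) / 2) (s := s) (integrableOn_psi_sub_self_rpow (by linarith)) (by linarith)
  have hq := integrable_ofReal_mul_cpow (g := fun x : ℝ => ψ x - θ x)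
    (measurable_psi.sub Mertens.measurable_theta) (σ₁ := (1 + s.re) / 2) (s := s)
    (integrableOn_psi_sub_theta_rpow (by linarith)) (by linarith)
  have h := mellinIoi_sub' hψ hq
  have hfun : (fun x : ℝ => (ψ x - x) - (ψ x - θ x)) = fun x => θ x - x := by
    funext x; ring
  rw [hfun] at h
  rw [h, mellinIoi_psi_sub_self hs]

/-- **Fubini step**: for `σ > 1`,
`∫_1^∞ x T(x) x^{-s-1} dx = (∫_1^∞ (θ(t) − t) t^{-s-1} dt − C₁)/(1 − s)`, `C₁ = ∫_1^∞ g`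
(swap `∫_1^∞ x^{-s} ∫_x^∞ g(t) dt dx = ∫_1^∞ g(t) ∫_1^t x^{-s} dx dt`, and `∫_1^t x^{-s} dx = (t^{1−s} − 1)/(1 − s)`) —
the source's "using integration by parts" for `F(s)`. [cite: Zhao2025MertensMean, §3 (display defining F(s))] -/
theorem mellinIoi_mul_tail {s : ℂ} (hs : 1 < s.re) :
    mellinIoi (fun x : ℝ => x * ∫ t in Ioi x, (θ t - t) / t ^ 2) s =
      (mellinIoi (fun t : ℝ => θ t - t) s - ((∫ t in Ioi (1 : ℝ), (θ t - t) / t ^ 2 : ℝ) : ℂ)) / (1 - s) := by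
  set g : ℝ → ℝ := fun t => (θ t - t) / t ^ 2 with hg
  set μ : Measure ℝ := volume.restrict (Ioi (1 : ℝ)) with hμ
  have hs1 : (1 : ℂ) - s ≠ 0 := by
    intro h; have := congrArg Complex.re h; simp at this; linarith
  -- the double integrand
  set F : ℝ → ℝ → ℂ := fun x t => if x < t then (g t : ℂ) * (x : ℂ) ^ (-s) else 0 with hF
  have hFm : Measurable (Function.uncurry F) := by
    have : Function.uncurry F =
        fun p : ℝ × ℝ => if p.1 < p.2 then (g p.2 : ℂ) * (p.1 : ℂ) ^ (-s) else 0 := by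
      funext p; rfl
    rw [this]
    exact Measurable.ite (measurableSet_lt measurable_fst measurable_snd)
      ((Complex.measurable_ofReal.comp (measurable_thetaKernel.comp measurable_snd)).mul
        ((Complex.measurable_ofReal.comp measurable_fst).pow_const _)) measurable_const
  have hgi : Integrable g μ := integrableOn_thetaKernel_Ioi_one
  have hpi : Integrable (fun x : ℝ => x ^ (-s.re)) μ :=
    integrableOn_Ioi_rpow_of_lt (by linarith) zero_lt_one
  have hFint : Integrable (Function.uncurry F) (μ.prod μ) := by
    refine Integrable.mono' (hpi.mul_prod hgi.norm) hFm.aestronglyMeasurable ?_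
    rw [hμ, Measure.prod_restrict, ae_restrict_iff' (measurableSet_Ioi.prod measurableSet_Ioi)]
    refine Eventually.of_forall fun p hp => ?_
    have hx : 1 < p.1 := hp.1
    have hx0 : 0 < p.1 := by linarith
    simp only [Function.uncurry, hF]
    split_ifs
    · rw [norm_mul, Complex.norm_cpow_eq_rpow_re_of_pos hx0, Complex.neg_re, Complex.norm_real, mul_comm]
    · rw [norm_zero]
      exact mul_nonneg (Real.rpow_nonneg hx0.le _) (norm_nonneg (g p.2))
  have hswap := integral_integral_swap hFint
  -- inner integral in `t`: `T(x) x^{-s}`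
  have hL : ∀ x ∈ Ioi (1 : ℝ), ∫ t, F x t ∂μ = ((∫ t in Ioi x, g t : ℝ) : ℂ) * (x : ℂ) ^ (-s) := by
    intro x hx
    have hx1 : 1 < x := hx
    have : ∀ t, F x t = (Ioi x).indicator (fun t => (g t : ℂ) * (x : ℂ) ^ (-s)) t := by
      intro t; simp only [hF, indicator, mem_Ioi]
    simp_rw [this]
    rw [hμ, integral_indicator measurableSet_Ioi, Measure.restrict_restrict measurableSet_Ioi,
      Ioi_inter_Ioi, sup_eq_left.2 hx1.le, integral_mul_const, integral_complex_ofReal]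
  -- inner integral in `x`: `g(t) (t^{1-s} − 1)/(1 − s)`
  have hR : ∀ t ∈ Ioi (1 : ℝ), ∫ x, F x t ∂μ = (g t : ℂ) * (((t : ℂ) ^ (1 - s) - 1) / (1 - s)) := by
    intro t ht
    have ht1 : 1 < t := ht
    have : ∀ x, F x t = (Iio t).indicator (fun x => (g t : ℂ) * (x : ℂ) ^ (-s)) x := by
      intro x; simp only [hF, indicator, mem_Iio]
    simp_rw [this]
    rw [hμ, integral_indicator measurableSet_Iio, Measure.restrict_restrict measurableSet_Iio]
    have hset : Iio t ∩ Ioi 1 = Ioo 1 t := by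
      ext x; simp only [mem_inter_iff, mem_Iio, mem_Ioi, mem_Ioo]; exact and_comm
    rw [hset, integral_const_mul, ← integral_Ioc_eq_integral_Ioo, ← intervalIntegral.integral_of_le ht1.le,
      integral_cpow (Or.inr ⟨fun h => hs1 (by linear_combination h), by
        rw [uIcc_of_le ht1.le]; exact fun h => by linarith [h.1]⟩)]
    push_cast
    rw [show -s + 1 = 1 - s by ring, one_cpow]
  -- integrability of the `θ`-Mellin integrand
  have hθ := integrable_ofReal_mul_cpow (g := fun t : ℝ => θ t - t) (Mertens.measurable_theta.sub measurable_id)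
    (σ₁ := (1 + s.re) / 2) (s := s) (integrableOn_theta_sub_self_rpow (by linarith)) (by linarith)
  have hgi' : Integrable (fun t : ℝ => (g t : ℂ)) (volume.restrict (Ioi (1 : ℝ))) := hgi.ofReal
  calc mellinIoi (fun x : ℝ => x * ∫ t in Ioi x, g t) s = ∫ x, ∫ t, F x t ∂μ ∂μ := by
        rw [mellinIoi, hμ]
        refine setIntegral_congr_fun measurableSet_Ioi fun x hx => ?_
        rw [hL x hx]
        have hx0 : (x : ℂ) ≠ 0 := by exact_mod_cast (zero_lt_one.trans hx).ne'
        push_cast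
        rw [show -(s + 1) = -s + (-1 : ℂ) by ring, Complex.cpow_add _ _ hx0, Complex.cpow_neg_one]
        field_simp
    _ = ∫ t, ∫ x, F x t ∂μ ∂μ := hswap
    _ = ∫ t in Ioi (1 : ℝ), (1 - s)⁻¹ * (((θ t - t : ℝ) : ℂ) * (t : ℂ) ^ (-(s + 1)) - (g t : ℂ)) := by
        rw [hμ]
        refine setIntegral_congr_fun measurableSet_Ioi fun t ht => ?_
        rw [hR t ht]
        have ht0 : (t : ℂ) ≠ 0 := by exact_mod_cast (zero_lt_one.trans ht).ne'
        simp only [hg]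
        push_cast
        rw [show -(s + 1) = (1 - s) - 2 by ring, Complex.cpow_sub (1 - s) 2 ht0, Complex.cpow_two]
        field_simp
    _ = (mellinIoi (fun t : ℝ => θ t - t) s - ((∫ t in Ioi (1 : ℝ), g t : ℝ) : ℂ)) / (1 - s) := by
        rw [integral_const_mul, integral_sub hθ hgi', integral_complex_ofReal, mellinIoi]
        field_simp

/-- **The transform of `L(x) = 2C − x T(x)`** on `σ > 1`:
`∫_1^∞ L(x) x^{-s-1} dx = 2C/s + B(s)/(s − 1)`, `B(s) = −(ζ₁'/ζ₁(s) + 1)/s − Q(s) − C₁` — the source's `F(s)`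
display (with `ζ'/(sζ) + 1/(s−1) = ((s−1)^{-1} − ... )` rewritten through `ζ₁ = (s − 1)ζ`).
[cite: Zhao2025MertensMean, §3 (display defining F(s))] -/
theorem mellinIoi_zhaoL {s : ℂ} (hs : 1 < s.re) :
    mellinIoi (fun x : ℝ => 2 * (∫ t in Ioi (2 : ℝ), (θ t - t) / t ^ 2) -
        x * ∫ t in Ioi x, (θ t - t) / t ^ 2) s =
      2 * ((∫ t in Ioi (2 : ℝ), (θ t - t) / t ^ 2 : ℝ) : ℂ) / s +
        (-(logDeriv riemannZeta₁ s + 1) / s - mellinIoi (fun x : ℝ => ψ x - θ x) s -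
          ((∫ t in Ioi (1 : ℝ), (θ t - t) / t ^ 2 : ℝ) : ℂ)) / (s - 1) := by
  set C : ℝ := ∫ t in Ioi (2 : ℝ), (θ t - t) / t ^ 2 with hC
  have hs1 : s - 1 ≠ 0 := by
    intro h; have := congrArg Complex.re h; simp at this; linarith
  have hs1' : (1 : ℂ) - s ≠ 0 := by
    intro h; have := congrArg Complex.re h; simp at this; linarith
  have hs0 : s ≠ 0 := by rintro rfl; simp at hs; linarith
  have hc := integrable_ofReal_mul_cpow (g := fun _ : ℝ => 2 * C) measurable_const (σ₁ := s.re / 2)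
    (s := s) (integrableOn_const_rpow _ (by linarith)) (by linarith)
  have hm := integrable_ofReal_mul_cpow (g := fun x : ℝ => x * ∫ t in Ioi x, (θ t - t) / t ^ 2)
    (measurable_id.mul measurable_tail) (σ₁ := (1 + s.re) / 2) (s := s)
    (integrableOn_mul_tail_rpow (by linarith)) (by linarith)
  rw [mellinIoi_sub' hc hm, mellinIoi_const _ (by linarith), mellinIoi_mul_tail hs,
    mellinIoi_theta_sub_self hs]
  push_cast
  field_simp
  ring

/-- Absolute convergence of the transform of `L(x) = 2C − x T(x)` at every `σ > 1`.
[cite: Zhao2025MertensMean, §3 (proof of Thm 1, necessity)] -/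
theorem integrableOn_zhaoL_rpow {σ : ℝ} (hσ : 1 < σ) :
    IntegrableOn (fun x : ℝ => (2 * (∫ t in Ioi (2 : ℝ), (θ t - t) / t ^ 2) -
        x * ∫ t in Ioi x, (θ t - t) / t ^ 2) * x ^ (-(σ + 1))) (Ioi 1) :=
  integrableOn_sub_rpow (f := fun _ : ℝ => 2 * ∫ t in Ioi (2 : ℝ), (θ t - t) / t ^ 2)
    (integrableOn_const_rpow _ (by linarith)) (integrableOn_mul_tail_rpow hσ)

/-- **The transform of `η L(x) + M`** (`η, M` real constants) on `σ > 1`: `η (2C/s + B(s)/(s − 1)) + M/s` — the affine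
modifications of `L` needed for "arbitrarily large positive and negative values" in §3.
[cite: Zhao2025MertensMean, §3 (display defining F(s))] -/
theorem mellinIoi_affine_zhaoL (η M : ℝ) {s : ℂ} (hs : 1 < s.re) :
    mellinIoi (fun x : ℝ => η * (2 * (∫ t in Ioi (2 : ℝ), (θ t - t) / t ^ 2) -
        x * ∫ t in Ioi x, (θ t - t) / t ^ 2) + M) s =
      η * (2 * ((∫ t in Ioi (2 : ℝ), (θ t - t) / t ^ 2 : ℝ) : ℂ) / s +
        (-(logDeriv riemannZeta₁ s + 1) / s - mellinIoi (fun x : ℝ => ψ x - θ x) s -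
          ((∫ t in Ioi (1 : ℝ), (θ t - t) / t ^ 2 : ℝ) : ℂ)) / (s - 1)) + M / s := by
  have hL := integrable_ofReal_mul_cpow
    (g := fun x : ℝ => η * (2 * (∫ t in Ioi (2 : ℝ), (θ t - t) / t ^ 2) - x * ∫ t in Ioi x, (θ t - t) / t ^ 2))
    ((measurable_const.sub (measurable_id.mul measurable_tail)).const_mul η) (σ₁ := (1 + s.re) / 2) (s := s)
    (integrableOn_const_mul_rpow η (integrableOn_zhaoL_rpow (by linarith))) (by linarith)
  have hM := integrable_ofReal_mul_cpow (g := fun _ : ℝ => M) measurable_const (σ₁ := s.re / 2)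
    (s := s) (integrableOn_const_rpow _ (by linarith)) (by linarith)
  rw [mellinIoi_add' hL hM, mellinIoi_const_mul, mellinIoi_zhaoL hs, mellinIoi_const _ (by linarith)]

/-! ### Landau's theorem and the contradiction with a zero off the line -/

/-- **The contradiction** (the source: "If `A_1(X) > 0` for all sufficiently large `X`, then a standard application
of Landau's oscillation theorem … leads to a contradiction", here for the integrated error term itself): if
`L(x) = 2C − x T(x) ≥ 0` for `x > X₁ ≥ 1` and `ζ(ρ₀) = 0` with `Re ρ₀ > 1/2`, then `False`. The continuation
`Φ(s) = 2C/s + dslope B 1 s` of the transform is holomorphic on `{Re s > 1/2, ζ₁(s) ≠ 0} ∋ 1` (`B(1) = 0` by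
Lemma 7 (1): `ζ₁'(1) = γ`, `∫_1^∞ (ψ−θ)/t² = Σ_p log p/(p(p−1))`, `C₁ = −1 − γ − Σ_p log p/(p(p−1))`), hence on
`{Re s > 2}` and on a strip about the zero-free real ray `(b, ∞)`, `1/2 < b < Re ρ₀`; Landau's theorem gives
absolute convergence for `σ > b`, so `ζ₁' = a ζ₁` on `Re s > b` with `a` holomorphic, and `ρ₀` propagates to `ζ₁ ≡ 0`,
contradicting `ζ₁(1) = 1`. Stated for the affine modifications `η L + M ≥ 0` (`η = ±1`, `M` real; transform
`η Φ + M/s`), which is what "attains arbitrarily large positive and negative values" requires, and with the power term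
`κ x^c` (`c < 1`, `c < Re ρ₀`; transform `κ/(s − c)`, holomorphic on `Re s > c`, the abscissa `b` taken above
`max(1/2, c)`) of the source's `A₁(X) = X^{Θ−1−ε} + ∫_X^∞ (ψ − x)/x²`, which is what the rate in (3.1) requires.
[cite: Zhao2025MertensMean, §3 (proof of Thm 1, necessity; (3.1))] -/
theorem false_of_rpow_affine_zhaoL_nonneg_of_zero {X₁ : ℝ} (hX₁ : 1 ≤ X₁) {η : ℝ} (hη : η = 1 ∨ η = -1)
    (κ M : ℝ) {c : ℝ} (hc1 : c < 1)
    (hpos : ∀ x : ℝ, X₁ < x → 0 ≤ κ * x ^ c +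
      (η * (2 * (∫ t in Ioi (2 : ℝ), (θ t - t) / t ^ 2) - x * ∫ t in Ioi x, (θ t - t) / t ^ 2) + M))
    {ρ₀ : ℂ} (hζ : riemannZeta ρ₀ = 0) (hρ : 1 / 2 < ρ₀.re) (hcρ : c < ρ₀.re) : False := by
  have hηsq : (η : ℂ) * η = 1 := by
    rcases hη with rfl | rfl <;> push_cast <;> norm_num
  set C : ℝ := ∫ t in Ioi (2 : ℝ), (θ t - t) / t ^ 2 with hCdef
  set C₁ : ℝ := ∫ t in Ioi (1 : ℝ), (θ t - t) / t ^ 2 with hC₁def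
  set L : ℝ → ℝ := fun x => κ * x ^ c + (η * (2 * C - x * ∫ t in Ioi x, (θ t - t) / t ^ 2) + M) with hLdef
  set Q : ℂ → ℂ := mellinIoi (fun x : ℝ => ψ x - θ x) with hQdef
  set B : ℂ → ℂ := fun s => -(logDeriv riemannZeta₁ s + 1) / s - Q s - C₁ with hBdef
  set Φ : ℂ → ℂ := fun s => κ * (1 / (s - c)) + (η * (2 * (C : ℂ) / s + dslope B 1 s) + M / s) with hΦdef
  -- the abscissa `b`, `max(1/2, c) < b < Re ρ₀ < 1`
  have hρ1 : ρ₀.re < 1 := by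
    by_contra h
    exact riemannZeta_ne_zero_of_one_le_re (not_lt.1 h) hζ
  set m : ℝ := max (1 / 2) c with hmdef
  have hm2 : 1 / 2 ≤ m := le_max_left _ _
  have hmc : c ≤ m := le_max_right _ _
  have hmρ : m < ρ₀.re := max_lt hρ hcρ
  have hm1 : m < 1 := max_lt (by norm_num) hc1
  set b : ℝ := (m + ρ₀.re) / 2 with hbdef
  have hmb : m < b := by rw [hbdef]; linarith
  have hb : 1 / 2 < b := lt_of_le_of_lt hm2 hmb
  have hbc : c < b := lt_of_le_of_lt hmc hmb
  have hbρ : b < ρ₀.re := by rw [hbdef]; linarith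
  -- measurability and absolute convergence at `σ₁ = 2`
  have hKm : Measurable fun x : ℝ => κ * x ^ c := (measurable_id.pow_const c).const_mul κ
  have hAm : Measurable fun x : ℝ => η * (2 * C - x * ∫ t in Ioi x, (θ t - t) / t ^ 2) + M :=
    ((measurable_const.sub (measurable_id.mul measurable_tail)).const_mul η).add_const M
  have hLm : Measurable L := hKm.add hAm
  have hK2 : IntegrableOn (fun x : ℝ => (κ * x ^ c) * x ^ (-((2 : ℝ) + 1))) (Ioi 1) :=
    integrableOn_const_mul_rpow κ (integrableOn_rpow_rpow (by linarith))
  have hA2 : IntegrableOn (fun x : ℝ =>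
      (η * (2 * C - x * ∫ t in Ioi x, (θ t - t) / t ^ 2) + M) * x ^ (-((2 : ℝ) + 1))) (Ioi 1) :=
    integrableOn_add_rpow (g := fun _ : ℝ => M)
      (integrableOn_const_mul_rpow η (integrableOn_zhaoL_rpow (by norm_num : (1 : ℝ) < 2)))
      (integrableOn_const_rpow _ (by norm_num))
  have hint : IntegrableOn (fun x => L x * x ^ (-((2 : ℝ) + 1))) (Ioi 1) := integrableOn_add_rpow hK2 hA2
  -- `Q` is holomorphic on `Re s > 1/2`
  have hQd : DifferentiableOn ℂ Q {s : ℂ | 1 / 2 < s.re} :=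
    differentiableOn_mellinIoi_of_forall (measurable_psi.sub Mertens.measurable_theta)
      fun σ' hσ' => integrableOn_psi_sub_theta_rpow hσ'
  -- `B`, `dslope B 1`, `Φ` are holomorphic on `U₀ = {Re s > max(1/2, c), ζ₁ s ≠ 0}`
  set U₀ : Set ℂ := {s : ℂ | m < s.re ∧ riemannZeta₁ s ≠ 0} with hU₀def
  have hU₀o : IsOpen U₀ :=
    (isOpen_lt continuous_const Complex.continuous_re).inter
      (isOpen_ne_fun differentiable_riemannZeta₁.continuous continuous_const)
  have hBd : DifferentiableOn ℂ B U₀ := by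
    intro s hs
    have hsm : m < s.re := hs.1
    have hs0 : s ≠ 0 := by
      rintro rfl
      rw [Complex.zero_re] at hsm
      linarith
    have d2 : DifferentiableAt ℂ (logDeriv riemannZeta₁) s :=
      (PsiOneExplicit.analyticAt_logDeriv_riemannZeta₁ hs.2).differentiableAt
    have dQ : DifferentiableAt ℂ Q s :=
      hQd.differentiableAt ((isOpen_lt continuous_const Complex.continuous_re).mem_nhds
        (show (1 : ℝ) / 2 < s.re from lt_of_le_of_lt hm2 hsm))
    exact ((((d2.add_const 1).neg.div differentiableAt_id hs0).sub dQ).sub_const _).differentiableWithinAt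
  have h1U₀ : (1 : ℂ) ∈ U₀ :=
    ⟨by rw [Complex.one_re]; exact hm1, by rw [riemannZeta₁_one]; exact one_ne_zero⟩
  have hdB : DifferentiableOn ℂ (dslope B 1) U₀ := (differentiableOn_dslope (hU₀o.mem_nhds h1U₀)).2 hBd
  have hΦd : DifferentiableOn ℂ Φ U₀ := by
    intro s hs
    have hsm : m < s.re := hs.1
    have hs0 : s ≠ 0 := by
      rintro rfl
      rw [Complex.zero_re] at hsm
      linarith
    have hsc : s - (c : ℂ) ≠ 0 := by
      intro h
      have := congrArg Complex.re h
      simp at this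
      linarith
    have dC : DifferentiableAt ℂ (fun z : ℂ => 2 * (C : ℂ) / z) s :=
      (differentiableAt_const _).div differentiableAt_id hs0
    have dM : DifferentiableAt ℂ (fun z : ℂ => (M : ℂ) / z) s :=
      (differentiableAt_const _).div differentiableAt_id hs0
    have d1 : DifferentiableAt ℂ (fun z : ℂ => z - (c : ℂ)) s := differentiableAt_id.sub_const _
    have d0 : DifferentiableAt ℂ (fun z : ℂ => (κ : ℂ) * (1 / (z - c))) s :=
      ((differentiableAt_const (1 : ℂ)).fun_div d1 hsc).const_mul (κ : ℂ)
    exact d0.differentiableWithinAt.add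
      (((dC.differentiableWithinAt.add (hdB s hs)).const_mul _).add dM.differentiableWithinAt)
  -- `B(1) = 0` (Lemma 7 (1) of the source, through the tree's constants)
  have hQ1 : Q 1 = ((∑' p : Nat.Primes, Real.log (p : ℝ) / ((p : ℝ) * ((p : ℝ) - 1)) : ℝ) : ℂ) := by
    have h := mellinIoiLog_ofReal (g := fun x : ℝ => ψ x - θ x) 0 1
    rw [mellinIoiLog_zero, Complex.ofReal_one] at h
    show mellinIoi (fun x : ℝ => ψ x - θ x) 1 = _
    rw [h, ← RosserSchoenfeld.integral_Ioi_psi_sub_theta_div_sq]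
    congr 1
    rw [pow_zero, one_mul]
    refine setIntegral_congr_fun measurableSet_Ioi fun x hx => ?_
    have hx0 : 0 < x := zero_lt_one.trans hx
    rw [pow_zero, mul_one, show (-((1 : ℝ) + 1)) = -(2 : ℝ) by norm_num, Real.rpow_neg hx0.le, Real.rpow_two,
      div_eq_mul_inv]
  have hLD1 : logDeriv riemannZeta₁ 1 = (Real.eulerMascheroniConstant : ℂ) := by
    rw [logDeriv_apply, deriv_riemannZeta₁_one, riemannZeta₁_one, div_one]
  have hC₁ : C₁ = -1 - Real.eulerMascheroniConstant -
      ∑' p : Nat.Primes, Real.log (p : ℝ) / ((p : ℝ) * ((p : ℝ) - 1)) :=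
    RosserSchoenfeld.integral_Ioi_theta_sub_self_div_sq
  have hB1 : B 1 = 0 := by
    simp only [hBdef]
    rw [hQ1, hLD1, hC₁]
    push_cast
    ring
  -- the value of `Φ` away from `1`
  have hΦ_of_ne : ∀ s : ℂ, s ≠ 1 →
      Φ s = κ * (1 / (s - c)) + (η * (2 * (C : ℂ) / s + B s / (s - 1)) + M / s) := by
    intro s hs1
    simp only [hΦdef]
    rw [dslope_of_ne _ hs1, slope_def_field, hB1, sub_zero]
  -- the strip `W₀` about the real ray `(b, ∞)`
  obtain ⟨δ, hδ, -, hgap⟩ := ZetaZeroSum.exists_gap_im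
  set W₀ : Set ℂ := {s : ℂ | b < s.re ∧ -(2 * δ) < s.im ∧ s.im < 2 * δ} with hW₀
  have hW₀o : IsOpen W₀ :=
    (isOpen_lt continuous_const Complex.continuous_re).inter
      ((isOpen_lt continuous_const Complex.continuous_im).inter
        (isOpen_lt Complex.continuous_im continuous_const))
  have hW₀c : Convex ℝ W₀ := by
    have : W₀ = {s : ℂ | b < s.re} ∩ ({s : ℂ | -(2 * δ) < s.im} ∩ {s : ℂ | s.im < 2 * δ}) := by
      ext s; simp [hW₀]
    rw [this]
    exact (convex_halfSpace_re_gt _).inter ((convex_halfSpace_im_gt _).inter (convex_halfSpace_im_lt _))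
  have hW₀r : ∀ σ' : ℝ, b < σ' → σ' ≤ 2 + 1 → (σ' : ℂ) ∈ W₀ := by
    intro σ' h1 _
    simp only [hW₀, Set.mem_setOf_eq, Complex.ofReal_re, Complex.ofReal_im]
    exact ⟨h1, by linarith, by linarith⟩
  have hsub : {s : ℂ | 2 < s.re} ∪ W₀ ⊆ U₀ := by
    rintro s (hs | hs)
    · simp only [Set.mem_setOf_eq] at hs
      have hs1 : s ≠ 1 := by rintro rfl; simp at hs
      refine ⟨by linarith, ?_⟩
      rw [Ne, riemannZeta₁_eq_zero_iff hs1]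
      exact riemannZeta_ne_zero_of_one_lt_re (by linarith)
    · exact ⟨lt_trans hmb hs.1, PsiOneExplicit.riemannZeta₁_ne_zero_of_abs_im_lt hgap
        (abs_lt.2 ⟨hs.2.1, hs.2.2⟩) (by linarith [hs.1])⟩
  have hΦd' : DifferentiableOn ℂ Φ ({s : ℂ | 2 < s.re} ∪ W₀) := hΦd.mono hsub
  have hagree : EqOn Φ (mellinIoi L) {s : ℂ | 2 < s.re} := by
    intro s hs
    simp only [Set.mem_setOf_eq] at hs
    have hs1 : s ≠ 1 := by rintro rfl; simp at hs
    have h1 := integrable_ofReal_mul_cpow hKm hK2 hs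
    have h2 := integrable_ofReal_mul_cpow hAm hA2 hs
    rw [hΦ_of_ne s hs1, hLdef, mellinIoi_add' h1 h2, mellinIoi_const_mul, mellinIoi_rpow (by linarith : c < s.re),
      mellinIoi_affine_zhaoL η M (by linarith : 1 < s.re)]
  -- Landau: absolute convergence for every `σ > b`
  have hLandau : ∀ σ' : ℝ, b < σ' → IntegrableOn (fun x => L x * x ^ (-(σ' + 1))) (Ioi 1) :=
    fun σ' hσ' => Landau.integrableOn_of_differentiableOn_union_convex hLm hint hX₁ hpos
      (by linarith : b < 2) hW₀o hW₀c hW₀r hΦd' hagree hσ'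
  -- the transform is holomorphic on `U = {Re s > b}`
  set F : ℂ → ℂ := mellinIoi L with hF
  set U : Set ℂ := {s : ℂ | b < s.re} with hU
  have hUo : IsOpen U := isOpen_lt continuous_const Complex.continuous_re
  have hFd : DifferentiableOn ℂ F U := differentiableOn_mellinIoi_of_forall hLm hLandau
  -- the coefficient `a` with `ζ₁' = a ζ₁`
  set a : ℂ → ℂ := fun s =>
    -(s * ((η * (F s - κ * (1 / (s - c)) - M / s) - 2 * (C : ℂ) / s) * (s - 1) + Q s + C₁)) - 1 with ha
  have had : DifferentiableOn ℂ a U := by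
    intro s hs
    have hsb : b < s.re := hs
    have hs0 : s ≠ 0 := by
      rintro rfl
      rw [Complex.zero_re] at hsb
      linarith
    have hsc : s - (c : ℂ) ≠ 0 := by
      intro h
      have := congrArg Complex.re h
      simp at this
      linarith
    have d0 : DifferentiableAt ℂ (fun z : ℂ => 2 * (C : ℂ) / z) s :=
      (differentiableAt_const _).div differentiableAt_id hs0
    have dQ : DifferentiableAt ℂ Q s :=
      hQd.differentiableAt ((isOpen_lt continuous_const Complex.continuous_re).mem_nhds
        (show 1 / 2 < s.re from lt_trans hb hs))
    have dM : DifferentiableAt ℂ (fun z : ℂ => (M : ℂ) / z) s :=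
      (differentiableAt_const _).div differentiableAt_id hs0
    have d1 : DifferentiableAt ℂ (fun z : ℂ => z - (c : ℂ)) s := differentiableAt_id.sub_const _
    have dK : DifferentiableAt ℂ (fun z : ℂ => (κ : ℂ) * (1 / (z - c))) s :=
      ((differentiableAt_const (1 : ℂ)).fun_div d1 hsc).const_mul (κ : ℂ)
    have dF' : DifferentiableWithinAt ℂ (fun z : ℂ => F z - κ * (1 / (z - c)) - M / z) U s :=
      ((hFd s hs).sub dK.differentiableWithinAt).sub dM.differentiableWithinAt
    exact ((differentiableWithinAt_id.mul (((((dF'.const_mul (η : ℂ)).sub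
      d0.differentiableWithinAt).mul (differentiableWithinAt_id.sub_const 1)).add dQ.differentiableWithinAt).add_const
      _)).neg).sub_const _
  -- `ζ₁' = a ζ₁` on `Re s > 2`, hence on `U`
  have hODE₂ : ∀ s : ℂ, 2 < s.re → deriv riemannZeta₁ s = a s * riemannZeta₁ s := by
    intro s hs
    have hs1 : s ≠ 1 := by rintro rfl; simp at hs
    have hs0 : s ≠ 0 := by rintro rfl; simp at hs; linarith
    have hs1' : s - 1 ≠ 0 := sub_ne_zero.2 hs1
    have hζ₁ : riemannZeta₁ s ≠ 0 := by
      rw [Ne, riemannZeta₁_eq_zero_iff hs1]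
      exact riemannZeta_ne_zero_of_one_lt_re (by linarith)
    have hFs : F s = κ * (1 / (s - c)) + (η * (2 * (C : ℂ) / s + B s / (s - 1)) + M / s) := by
      rw [← hΦ_of_ne s hs1]
      exact (hagree hs).symm
    have e0 : (η : ℂ) * (F s - κ * (1 / (s - c)) - M / s) = 2 * (C : ℂ) / s + B s / (s - 1) := by
      rw [hFs]
      linear_combination (2 * (C : ℂ) / s + B s / (s - 1)) * hηsq
    have e1 : ((η : ℂ) * (F s - κ * (1 / (s - c)) - M / s) - 2 * (C : ℂ) / s) * (s - 1) = B s := by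
      rw [e0]
      field_simp
      ring
    have haL : a s = logDeriv riemannZeta₁ s := by
      simp only [ha]
      rw [e1]
      simp only [hBdef]
      field_simp
      ring
    rw [haL, logDeriv_apply, div_mul_cancel₀ _ hζ₁]
  have hODE : EqOn (deriv riemannZeta₁) (fun s => a s * riemannZeta₁ s) U := by
    set D : ℂ → ℂ := fun s => deriv riemannZeta₁ s - a s * riemannZeta₁ s with hD
    have hDd : DifferentiableOn ℂ D U := by
      intro s hs
      exact ((differentiable_riemannZeta₁.analyticAt s).deriv.differentiableAt.differentiableWithinAt).sub
        ((had s hs).mul (differentiable_riemannZeta₁ s).differentiableWithinAt)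
    have hDa : AnalyticOnNhd ℂ D U := hDd.analyticOnNhd hUo
    have hUpre : IsPreconnected U := (convex_halfSpace_re_gt b).isPreconnected
    have h3U : (3 : ℂ) ∈ U := by
      simp only [hU, Set.mem_setOf_eq]
      norm_num
      linarith
    have hev : D =ᶠ[𝓝 (3 : ℂ)] 0 := by
      have h3 : (3 : ℂ) ∈ {s : ℂ | 2 < s.re} := by
        simp only [Set.mem_setOf_eq]
        norm_num
      filter_upwards [(isOpen_lt continuous_const Complex.continuous_re).mem_nhds h3] with s hs
      simp only [hD, Pi.zero_apply, hODE₂ s hs, sub_self]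
    have hz := hDa.eqOn_zero_of_preconnected_of_eventuallyEq_zero hUpre h3U hev
    intro s hs
    have := hz hs
    simp only [hD, Pi.zero_apply, sub_eq_zero] at this
    exact this
  -- the zero `ρ₀` propagates
  have hρne : ρ₀ ≠ 1 := by
    rintro rfl
    exact riemannZeta_one_ne_zero hζ
  have hζ₁ : riemannZeta₁ ρ₀ = 0 := (riemannZeta₁_eq_zero_iff hρne).2 hζ
  have hzero := eq_zero_of_deriv_eq_mul differentiable_riemannZeta₁ hUo had hODE
    (show ρ₀ ∈ U from hbρ) hζ₁
  have h1 := congrFun hzero 1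
  rw [riemannZeta₁_one, Pi.zero_apply] at h1
  exact one_ne_zero h1

/-- **The contradiction, affine form** (`κ = 0`): if `η L(x) + M ≥ 0` for `x > X₁ ≥ 1` (`η = ±1`, `M` real) and
`ζ(ρ₀) = 0` with `Re ρ₀ > 1/2`, then `False` — what "attains arbitrarily large positive and negative values" requires.
[cite: Zhao2025MertensMean, §3 (proof of Thm 1, necessity)] -/
theorem false_of_affine_zhaoL_nonneg_of_zero {X₁ : ℝ} (hX₁ : 1 ≤ X₁) {η : ℝ} (hη : η = 1 ∨ η = -1) (M : ℝ)
    (hpos : ∀ x : ℝ, X₁ < x →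
      0 ≤ η * (2 * (∫ t in Ioi (2 : ℝ), (θ t - t) / t ^ 2) - x * ∫ t in Ioi x, (θ t - t) / t ^ 2) + M)
    {ρ₀ : ℂ} (hζ : riemannZeta ρ₀ = 0) (hρ : 1 / 2 < ρ₀.re) : False :=
  false_of_rpow_affine_zhaoL_nonneg_of_zero hX₁ hη 0 M (c := 0) zero_lt_one
    (fun x hx => by rw [zero_mul, zero_add]; exact hpos x hx) hζ hρ (lt_trans one_half_pos hρ)

/-- **The contradiction for `L` itself** (`η = 1`, `M = 0`): if `L(x) = 2C − x T(x) ≥ 0` for `x > X₁ ≥ 1` and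
`ζ(ρ₀) = 0` with `Re ρ₀ > 1/2`, then `False`. [cite: Zhao2025MertensMean, §3 (proof of Thm 1, necessity)] -/
theorem false_of_zhaoL_nonneg_of_zero {X₁ : ℝ} (hX₁ : 1 ≤ X₁)
    (hpos : ∀ x : ℝ, X₁ < x →
      0 ≤ 2 * (∫ t in Ioi (2 : ℝ), (θ t - t) / t ^ 2) - x * ∫ t in Ioi x, (θ t - t) / t ^ 2)
    {ρ₀ : ℂ} (hζ : riemannZeta ρ₀ = 0) (hρ : 1 / 2 < ρ₀.re) : False :=
  false_of_affine_zhaoL_nonneg_of_zero hX₁ (η := 1) (Or.inl rfl) 0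
    (fun x hx => by rw [one_mul, add_zero]; exact hpos x hx) hζ hρ

/-! ### Theorem 1 (`i = 1`), (b) ⟹ (a) -/

/-- **Zhao 2025, Theorem 1 (`i = 1`), necessity, PROVED in eventual form**: if `∫₂^X E₁(x) dx ≥ 0` for all
`X > X₁`, then the Riemann Hypothesis holds (a zero `ρ₀` with `Re ρ₀ > 1/2` is excluded by
`false_of_zhaoL_nonneg_of_zero` since `∫₂^X E₁ = 2C − X T(X)` by (2.1); the symmetry `ρ ↦ 1 − ρ̄` of the zeros,
`quasiRiemannHypothesis_one_half_iff_holds`, does the rest). [cite: Zhao2025MertensMean, Thm 1 (i = 1), (b) ⟹ (a); §3] -/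
theorem riemannHypothesis_of_integral_E₁_nonneg {X₁ : ℝ}
    (h : ∀ X : ℝ, X₁ < X → 0 ≤ ∫ x in (2 : ℝ)..X, E₁ x) : RiemannHypothesis := by
  refine quasiRiemannHypothesis_one_half_iff_holds.1 fun ρ₀ hζ hρ _ => ?_
  refine false_of_zhaoL_nonneg_of_zero (X₁ := max X₁ 2) (le_trans one_le_two (le_max_right _ _))
    (fun x hx => ?_) hζ hρ
  have hx2 : 2 ≤ x := (le_max_right _ _).trans hx.le
  rw [← integral_E₁_eq hx2]
  exact h x (lt_of_le_of_lt (le_max_left _ _) hx)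

/-- **Zhao 2025, Theorem 1 (`i = 1`), (b) ⟹ (a) as printed**: `(∀ X > 2, ∫₂^X E₁(x) dx > 0) ⟹ RH` — the `←`
direction of clause 1 of the named fact `Zhao2025MertensMean_thm1`, now a theorem.
[cite: Zhao2025MertensMean, Thm 1 (i = 1), (b) ⟹ (a)] -/
theorem riemannHypothesis_of_integral_E₁_pos
    (h : ∀ X : ℝ, 2 < X → 0 < ∫ x in (2 : ℝ)..X, E₁ x) : RiemannHypothesis :=
  riemannHypothesis_of_integral_E₁_nonneg (X₁ := 2) fun X hX => (h X hX).le

/-! ### If RH fails: arbitrarily large positive and negative values -/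

/-- If RH fails, `ζ` has a zero with real part `> 1/2` (symmetry `ρ ↦ 1 − ρ`,
`quasiRiemannHypothesis_one_half_iff_holds`). [cite: Zhao2025MertensMean, §3 ("Supposing that Θ > 1/2")] -/
theorem exists_zero_of_not_RH (hRH : ¬ RiemannHypothesis) :
    ∃ ρ₀ : ℂ, riemannZeta ρ₀ = 0 ∧ 1 / 2 < ρ₀.re := by
  have h : ¬ QuasiRiemannHypothesis (1 / 2) := fun h =>
    hRH (quasiRiemannHypothesis_one_half_iff_holds.1 h)
  unfold QuasiRiemannHypothesis at h
  push Not at h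
  obtain ⟨s, hs, h1, -⟩ := h
  exact ⟨s, hs, h1⟩

/-- **If RH is false, `∫₂^X E₁(x) dx` takes arbitrarily large positive values** — the source's "if RH is false, we
shall see that `∫₂^X E_i(x) dx` attains arbitrarily large positive and negative values" for `i = 1`, without the rate
`X^{Θ−ε}` of (3.1) (Landau applied to `M − L ≥ 0`). [cite: Zhao2025MertensMean, §3 (3.1), weak form] -/
theorem frequently_lt_integral_E₁_of_not_RH (hRH : ¬ RiemannHypothesis) (M : ℝ) :
    ∃ᶠ X : ℝ in atTop, M < ∫ x in (2 : ℝ)..X, E₁ x := by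
  obtain ⟨ρ₀, hζ, hρ⟩ := exists_zero_of_not_RH hRH
  by_contra hnot
  rw [Filter.not_frequently] at hnot
  obtain ⟨X, hX⟩ := Filter.eventually_atTop.1 hnot
  refine false_of_affine_zhaoL_nonneg_of_zero (X₁ := max X 2) (le_trans one_le_two (le_max_right _ _))
    (η := -1) (Or.inr rfl) M (fun x hx => ?_) hζ hρ
  have hx2 : 2 ≤ x := (le_max_right _ _).trans hx.le
  have := hX x ((le_max_left _ _).trans hx.le)
  rw [not_lt, integral_E₁_eq hx2] at this
  linarith

/-- **If RH is false, `∫₂^X E₁(x) dx` takes arbitrarily large negative values** (Landau applied to `L − M ≥ 0`).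
[cite: Zhao2025MertensMean, §3 (3.1), weak form] -/
theorem frequently_integral_E₁_lt_of_not_RH (hRH : ¬ RiemannHypothesis) (M : ℝ) :
    ∃ᶠ X : ℝ in atTop, ∫ x in (2 : ℝ)..X, E₁ x < M := by
  obtain ⟨ρ₀, hζ, hρ⟩ := exists_zero_of_not_RH hRH
  by_contra hnot
  rw [Filter.not_frequently] at hnot
  obtain ⟨X, hX⟩ := Filter.eventually_atTop.1 hnot
  refine false_of_affine_zhaoL_nonneg_of_zero (X₁ := max X 2) (le_trans one_le_two (le_max_right _ _))
    (η := 1) (Or.inl rfl) (-M) (fun x hx => ?_) hζ hρ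
  have hx2 : 2 ≤ x := (le_max_right _ _).trans hx.le
  have := hX x ((le_max_left _ _).trans hx.le)
  rw [not_lt, integral_E₁_eq hx2] at this
  linarith

/-! ### (3.1) for `i = 1`, with rate: `∫₂^X E₁ = Ω±(X^c)` for every `c < Re ρ₀` at a zero `ρ₀` off the line -/

/-- **(3.1), `i = 1`, `Ω₊` with rate**: if `ζ(ρ₀) = 0` with `Re ρ₀ > 1/2` and `c < Re ρ₀`, then `∫₂^X E₁(x) dx > X^c`
for arbitrarily large `X` (Landau applied to `X^c − ∫₂^X E₁ ≥ 0`, the source's `A₁` with `X^{Θ−1−ε}`; the printed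
`Ω±(X^{Θ−ε})`, `Θ = sup Re ρ`, is this statement zero by zero). [cite: Zhao2025MertensMean, §3 (3.1), i = 1] -/
theorem frequently_rpow_lt_integral_E₁_of_zero {ρ₀ : ℂ} (hζ : riemannZeta ρ₀ = 0) (hρ : 1 / 2 < ρ₀.re)
    {c : ℝ} (hc : c < ρ₀.re) : ∃ᶠ X : ℝ in atTop, X ^ c < ∫ x in (2 : ℝ)..X, E₁ x := by
  have hρ1 : ρ₀.re < 1 := by
    by_contra h
    exact riemannZeta_ne_zero_of_one_le_re (not_lt.1 h) hζ
  by_contra hnot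
  rw [Filter.not_frequently] at hnot
  obtain ⟨X, hX⟩ := Filter.eventually_atTop.1 hnot
  refine false_of_rpow_affine_zhaoL_nonneg_of_zero (X₁ := max X 2) (le_trans one_le_two (le_max_right _ _))
    (η := -1) (Or.inr rfl) 1 0 (lt_trans hc hρ1) (fun x hx => ?_) hζ hρ hc
  have hx2 : 2 ≤ x := (le_max_right _ _).trans hx.le
  have := hX x ((le_max_left _ _).trans hx.le)
  rw [not_lt, integral_E₁_eq hx2] at this
  linarith

/-- **(3.1), `i = 1`, `Ω₋` with rate**: if `ζ(ρ₀) = 0` with `Re ρ₀ > 1/2` and `c < Re ρ₀`, then `∫₂^X E₁(x) dx < −X^c`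
for arbitrarily large `X` (Landau applied to `X^c + ∫₂^X E₁ ≥ 0`). [cite: Zhao2025MertensMean, §3 (3.1), i = 1] -/
theorem frequently_integral_E₁_lt_neg_rpow_of_zero {ρ₀ : ℂ} (hζ : riemannZeta ρ₀ = 0) (hρ : 1 / 2 < ρ₀.re)
    {c : ℝ} (hc : c < ρ₀.re) : ∃ᶠ X : ℝ in atTop, ∫ x in (2 : ℝ)..X, E₁ x < -X ^ c := by
  have hρ1 : ρ₀.re < 1 := by
    by_contra h
    exact riemannZeta_ne_zero_of_one_le_re (not_lt.1 h) hζ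
  by_contra hnot
  rw [Filter.not_frequently] at hnot
  obtain ⟨X, hX⟩ := Filter.eventually_atTop.1 hnot
  refine false_of_rpow_affine_zhaoL_nonneg_of_zero (X₁ := max X 2) (le_trans one_le_two (le_max_right _ _))
    (η := 1) (Or.inl rfl) 1 0 (lt_trans hc hρ1) (fun x hx => ?_) hζ hρ hc
  have hx2 : 2 ≤ x := (le_max_right _ _).trans hx.le
  have := hX x ((le_max_left _ _).trans hx.le)
  rw [not_lt, integral_E₁_eq hx2] at this
  linarith

end Zhao2025

end Literature.NumberTheory.LFunctions
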